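import Literature.NumberTheory.NumberFields.RayClassFieldFrobeniusOrderGrowth
import Literature.NumberTheory.NumberFields.RayClassFieldSplitPrimePowerDegree
import HarnessLib

/-!
# THE LOCAL TOWER DATA OF THE (c)-CAPSTONE FROM ONE GLOBAL ELEMENT: with `𝔤 := 𝔤₀·v'^a`, `α_i := α^{p^{i+1}}`, `f_i := f·p^{i+1}`,
# offset `c = 1` and an unramified tower `E_j` of degree `d·p^j`, the binders `hα0 / hα𝔪 / hαw / hαπ / hdegE / hinert₀ / hcount` of
# `Summit…ColemanCoinvariantEllipticUnitsLiftable.charIdeal_coinvariants_colemanImage_closure_ellipticUnits_liftable_eq_span` HOLD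
# (de Shalit II.1.9 / II.1.10 / II.4.14 at an auxiliary prime `v'` of degree one, absolutely unramified)

The (c)-capstone for the elliptic units (brick §4(c) of crux `TwoVariableMainConjAtSplitTwoQuad`) carries, besides the Coleman-side frame, the
following LOCAL TOWER DATA for the moduli `𝔤·v'^{i+1}`: integers `α_i ≠ 0`, `α_i ≡ 1 mod 𝔤v'^{i+1}`, units off `v`, `α_i = π^{f_i}` in `K_v`;
`hdegE : f_i ∣ deg w` for the Weil elements fixing `E_{i+c}`; `hinert₀ :` every `τ ∈ Γ_{K_v}` fixing `ι K(𝔤v'^{i+1})` fixes `E_{i+c}`; and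
`hcount : [K(𝔤v'^{i+2}v^{k+1}) : K(𝔤v'^{i+1}v^{k+1})]·[E_{i+c}:K_v] ≤ [E_{i+1+c}:K_v]`.  THIS file discharges ALL of them from:
a non-zero `𝔤₀` with `v, v' ∤ 𝔤₀`, `w_{𝔤₀} = 1`; the auxiliary prime `v' ≠ v` above `p` of DEGREE ONE (`#𝓞/v' = p`) and ABSOLUTELY UNRAMIFIED
(`p ∈ v' ∖ v'²`); ONE `α ∈ 𝓞_K`, `α ≠ 0`, `α ≡ 1 mod 𝔤₀`, `(α) = 𝔭_v^f`, `α = π^f` in `K_v`, of `v'`-level `ℓ ≥ 1` with `α^p` of exact level `a + 1`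
(`a + 1 ≥ 2` or `p ≠ 2`); a monotone unramified tower `E_j ≤ K_v^{nr}` with `[E_j : K_v] = d·p^j`, `f ∣ d`, `d` prime to `p` and
`d ∣ ord Frob_v(K(𝔤₀)/K)`.  With `𝔤 := 𝔤₀·v'^a`, `α_i := α^{p^{i+1}}`, `f_i := f·p^{i+1}`, `c := 1`:

* `hw_of_towerData` (`w_{𝔤v'} = 1`), `towerData_hα0`, ★ `towerData_hα𝔪` (`α^{p^{i+1}} ≡ 1 mod 𝔤₀v'^{a+i+1}`: lifting the exponent from `α^p`),
  `towerData_hαw`, `towerData_hαπ`;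
* ★ `towerData_hdegE` (`f·p^{i+1} ∣ [E_{i+1}:K_v] ∣ deg w` on `Γ_{E_{i+1}}`, `mem_fieldSubgroup_iff_dvd_deg_of_le_maxUnramified`);
* ★★ `towerData_hinert` — INERT from level `0`: `[E_{i+1}:K_v] = d·p^{i+1} ∣ ord Frob_v(K(𝔤₀v'^{a+i+1}))`
  (`RayClassFieldFrobeniusOrderGrowth.mul_pow_prime_succ_dvd_orderOf_frob_idelic_of_pow_level`) fed to
  `mem_fixingSubgroup_of_forall_smul_absClosureEmbedding_eq_of_finrank_dvd_orderOf`;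
* ★ `towerData_hcount` — `[K(𝔤v'^{i+2}v^{k+1}) : K(𝔤v'^{i+1}v^{k+1})] = p` (`relfinrank_rayClassField_mul_pow_succ_succ` with `𝔣 = 𝔤₀v^{k+1}`,
  `𝔭 = v'`) and `[E_{i+2}] = p·[E_{i+1}]`.

For `K = ℚ(√−7)`, `v, v' ∣ 2`, `𝔤₀ = 𝔣 = (√−7)`: `α = π³` (`≡ 3 mod 8` at `v'`, so `ℓ = 1`, `α² ≡ 9 mod 16`, `a + 1 = 3`), `f = d = 3`, `𝔤 = 𝔣v'²`,
`c = 1` — the tower of `Cruxes/TwoVariableMainConjAtSplitTwoQuad/BRICK-C-TWOVAR-g15.md` §2 FINDING 2.  Theorems only; no `sorry`; no definitions.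

## References
* [deShalit1987] E. de Shalit, *Iwasawa theory of elliptic curves with complex multiplication* (1987), II.1.9 (p. 43), II.1.10 (p. 39),
  II.4.14 (p. 71), II.4.17 (p. 78).
* [Serre1973CourseArithmetic] J.-P. Serre, *A Course in Arithmetic* (1973), Ch. II §3.1.
* [NeukirchANT1999] J. Neukirch, *Algebraic Number Theory* (1999), Ch. VI §7 Thm. (7.1), Cor. (7.3); Ch. IV §4.
-/

noncomputable section

open NumberField IsDedekindDomain IsDedekindDomain.HeightOneSpectrum Field WithZero
open scoped nonZeroDivisors Classical

namespace Literature.NumberTheory.NumberFields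

open Literature.NumberTheory.GaloisRepresentations
open Literature.NumberTheory.GaloisRepresentations.IsNonarchimedeanLocalField
open Literature.NumberTheory.GaloisRepresentations.ArtinLocalGlobal
open Literature.RingTheory.DedekindDomain
open ValuativeRel

variable {K : Type} [Field K] [NumberField K] {𝔤₀ : Ideal (𝓞 K)} {v v' : HeightOneSpectrum (𝓞 K)}

/-! ### §0. Moduli bookkeeping -/

omit [NumberField K] in
/-- `𝔤₀v'^a·v'^{i+1} = 𝔤₀·v'^{a+(i+1)}`. [folklore] -/
private theorem moduli_eq₁₉ (a i : ℕ) : 𝔤₀ * v'.asIdeal ^ a * v'.asIdeal ^ (i + 1) = 𝔤₀ * v'.asIdeal ^ (a + (i + 1)) := by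
  rw [mul_assoc, ← pow_add]

omit [NumberField K] in
/-- `𝔤₀v'^a·v'^{i+1}·v^{k+1} = (𝔤₀v^{k+1})·v'^{(a+i)+1}`. [folklore] -/
private theorem moduli₂_eq₁₉ (a i k : ℕ) :
    𝔤₀ * v'.asIdeal ^ a * v'.asIdeal ^ (i + 1) * v.asIdeal ^ (k + 1) = 𝔤₀ * v.asIdeal ^ (k + 1) * v'.asIdeal ^ (a + i + 1) := by
  rw [show a + i + 1 = a + (i + 1) by ring, pow_add]; ring

/-- `v ∤ 𝔤₀v'^n` for `v ∤ 𝔤₀`, `v ≠ v'`. [cite: deShalit1987, II.4.14 (p. 71)] -/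
private theorem not_mul_pow_le₁₉ (hv : ¬ 𝔤₀ ≤ v.asIdeal) (hvv' : v' ≠ v) (n : ℕ) : ¬ 𝔤₀ * v'.asIdeal ^ n ≤ v.asIdeal := by
  intro h
  rcases (v.isPrime.mul_le).mp h with h1 | h2
  · exact hv h1
  · rcases n with _ | n
    · rw [pow_zero, Ideal.one_eq_top, top_le_iff] at h2
      exact v.isPrime.ne_top h2
    · exact hvv' (HeightOneSpectrum.ext ((v'.isMaximal.eq_of_le v.isPrime.ne_top ((Ideal.IsPrime.pow_le_iff (hP := v.isPrime)
        (Nat.succ_ne_zero n)).mp h2))))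

/-- A prime not containing `𝔪` is coprime to it. [folklore] -/
private theorem isCoprime_of_not_le₁₉ {𝔪 : Ideal (𝓞 K)} (h : ¬ 𝔪 ≤ v'.asIdeal) : IsCoprime 𝔪 v'.asIdeal := by
  rw [Ideal.isCoprime_iff_sup_eq]
  exact v'.isMaximal.out.2 _ (lt_of_le_of_ne le_sup_right fun e ↦ h (e ▸ le_sup_left))

variable [IsTotallyComplex K]
  (h𝔤0 : 𝔤₀ ≠ ⊥) (hv : ¬ 𝔤₀ ≤ v.asIdeal) (hv' : ¬ 𝔤₀ ≤ v'.asIdeal) (hvv' : v' ≠ v)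
  (hw𝔤 : ∀ u : (𝓞 K)ˣ, (u : 𝓞 K) - 1 ∈ 𝔤₀ → u = 1)
  {p : ℕ} (hp : p.Prime) (hdeg1 : Nat.card (𝓞 K ⧸ v'.asIdeal) = p) (hpv' : (p : 𝓞 K) ∈ v'.asIdeal) (hpv'2 : (p : 𝓞 K) ∉ v'.asIdeal ^ 2)
  {π : 𝒪[v.adicCompletion K]} (hπ : (valuation (v.adicCompletion K)).IsUniformizer (π : v.adicCompletion K))
  {α : 𝓞 K} (hα0 : α ≠ 0) (hα𝔤 : α - 1 ∈ 𝔤₀) (hαw : ∀ w : HeightOneSpectrum (𝓞 K), w ≠ v → α ∉ w.asIdeal)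
  {f : ℕ} (hαf : Ideal.span {α} = v.asIdeal ^ f) (hαπ : ((α : K) : v.adicCompletion K) = (π : v.adicCompletion K) ^ f)
  {ℓ a : ℕ} (hℓ : 1 ≤ ℓ) (hαℓ : v'.intValuation (α - 1) = exp (-(ℓ : ℤ)))
  (ha2 : 2 ≤ a + 1 ∨ p ≠ 2) (hαa : v'.intValuation (α ^ p - 1) = exp (-((a + 1 : ℕ) : ℤ)))
  {d : ℕ} (hd : d.Coprime p) (hfd : f ∣ d) (hdvd : d ∣ orderOf (galFrob K (rayClassField K 𝔤₀) v))
  (E : ℕ → IntermediateField (v.adicCompletion K) (AlgebraicClosure (v.adicCompletion K)))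
  [∀ j, FiniteDimensional (v.adicCompletion K) (E j)]
  (hE : ∀ j, E j ≤ maxUnramified (v.adicCompletion K)) (hEdeg : ∀ j, Module.finrank (v.adicCompletion K) (E j) = d * p ^ j)

/-! ### §1. The `α`-data for the moduli `𝔤v'^{i+1}`, `𝔤 = 𝔤₀v'^a`: `α_i = α^{p^{i+1}}`, `f_i = f·p^{i+1}` -/

omit [NumberField K] [IsTotallyComplex K] in
include hw𝔤 in
/-- `w_{𝔤v'} = 1` for `𝔤 = 𝔤₀v'^a` (from `w_{𝔤₀} = 1`). [cite: deShalit1987, II.4.14 (p. 71)] -/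
theorem hw_of_towerData : ∀ u : (𝓞 K)ˣ, (u : 𝓞 K) - 1 ∈ 𝔤₀ * v'.asIdeal ^ a * v'.asIdeal → u = 1 :=
  fun u hu ↦ hw𝔤 u (Ideal.mul_le_right (Ideal.mul_le_right hu))

omit [NumberField K] [IsTotallyComplex K] in
include hα0 in
/-- `α^{p^{i+1}} ≠ 0` (the `hα0` binder of the two-variable tower). [cite: deShalit1987, II.4.14 (p. 71)] -/
theorem towerData_hα0 : ∀ i : ℕ, α ^ p ^ (i + 1) ≠ 0 := fun _ ↦ pow_ne_zero _ hα0

omit [IsTotallyComplex K] in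
include hv' hp hpv' hpv'2 hα𝔤 ha2 hαa in
/-- ★ **`α^{p^{i+1}} ≡ 1 mod 𝔤v'^{i+1}`** for `𝔤 = 𝔤₀v'^a`: `α^{p^{i+1}} = (α^p)^{p^i}` has `v'`-level EXACTLY `a + 1 + i` (lifting the exponent
from `α^p`), and is `≡ 1 mod 𝔤₀`. [cite: deShalit1987, II.1.9 (p. 43), II.4.17 (p. 78)] [cite: Serre1973CourseArithmetic, Ch. II §3.1] -/
theorem towerData_hα𝔪 (i : ℕ) : α ^ p ^ (i + 1) - 1 ∈ 𝔤₀ * v'.asIdeal ^ a * v'.asIdeal ^ (i + 1) := by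
  have h𝔤 : α ^ p ^ (i + 1) - 1 ∈ 𝔤₀ := by
    rw [← geom_sum_mul α (p ^ (i + 1))]
    exact Ideal.mul_mem_left _ _ hα𝔤
  have hv'mem : α ^ p ^ (i + 1) - 1 ∈ v'.asIdeal ^ (a + (i + 1)) := by
    have h := intValuation_pow_prime_pow_sub_one v' hp (intValuation_natCast_eq_of_mem_of_not_mem_sq v' hpv' hpv'2) (x := α ^ p)
      (m := a + 1) (by omega) ha2 hαa i
    rw [← pow_mul, ← pow_succ'] at h
    rw [← intValuation_le_pow_iff_mem, h, exp_le_exp]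
    push_cast
    omega
  rw [moduli_eq₁₉, Ideal.mul_eq_inf_of_isCoprime (isCoprime_of_not_le₁₉ hv').pow_right]
  exact ⟨h𝔤, hv'mem⟩

omit [NumberField K] [IsTotallyComplex K] in
include hαw in
/-- `α^{p^{i+1}}` is a unit at every finite `w ≠ v` (`(α_i) = 𝔭_v^{f_i}`, the `hαw` binder). [cite: deShalit1987, II.1.10 (p. 39), II.4.14 (p. 71)] -/
theorem towerData_hαw : ∀ i : ℕ, ∀ w : HeightOneSpectrum (𝓞 K), w ≠ v → α ^ p ^ (i + 1) ∉ w.asIdeal :=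
  fun _ w hw h ↦ hαw w hw (w.isPrime.mem_of_pow_mem _ h)

omit [IsTotallyComplex K] in
include hαπ in
/-- `α^{p^{i+1}} = π^{f·p^{i+1}}` in `K_v`. [cite: deShalit1987, II.1.10 (p. 39)] -/
theorem towerData_hαπ : ∀ i : ℕ, (((α ^ p ^ (i + 1) : 𝓞 K) : K) : v.adicCompletion K) = (π : v.adicCompletion K) ^ (f * p ^ (i + 1)) := by
  intro i
  have e1 : ((α ^ p ^ (i + 1) : 𝓞 K) : K) = (α : K) ^ p ^ (i + 1) := by push_cast; rfl
  rw [pow_mul, ← hαπ, e1, ← algebraMap_adicCompletion_apply, map_pow, algebraMap_adicCompletion_apply]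

/-! ### §2. `hdegE`, `hinert₀`, `hcount` for the unramified tower `E_j` of degree `d·p^j`, offset `c = 1` -/

omit [IsTotallyComplex K] in
include hfd hE hEdeg in
/-- ★ **`hdegE`**: a Weil element fixing `E_{i+1}` has `f·p^{i+1} ∣ [E_{i+1}:K_v] ∣ deg w`.
[cite: NeukirchANT1999, Ch. IV §4] [cite: deShalit1987, II.1.10 (p. 39)] -/
theorem towerData_hdegE [CharZero (v.adicCompletion K)] : ∀ i : ℕ, ∀ w : WeilGroup (v.adicCompletion K),
    WeilGroup.toAbsGalois (v.adicCompletion K) w ∈ (E (i + 1)).fixingSubgroup → ((f * p ^ (i + 1) : ℕ) : ℤ) ∣ WeilGroup.deg w := by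
  intro i w hw
  have hmem : w ∈ LocalWeilDatum.fieldSubgroup (v.adicCompletion K) (E (i + 1)) := by
    rw [LocalWeilDatum.mem_fieldSubgroup_iff]
    intro x hx
    rw [Field.absoluteGaloisGroup.smul_def]
    exact (IntermediateField.mem_fixingSubgroup_iff _ _).mp hw x hx
  have hdeg := (mem_fieldSubgroup_iff_dvd_deg_of_le_maxUnramified (hE (i + 1)) w).mp hmem
  rw [hEdeg (i + 1)] at hdeg
  exact (Int.natCast_dvd_natCast.mpr (mul_dvd_mul_right hfd _)).trans hdeg

include h𝔤0 hv hv' hvv' hw𝔤 hp hpv' hpv'2 hπ hα0 hα𝔤 hαf hℓ hαℓ ha2 hαa hd hdvd hE hEdeg in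
/-- ★★ **`hinert₀` (INERT from level `0`, offset `c = 1`)**: every `τ ∈ Γ_{K_v}` fixing `ι K(𝔤v'^{i+1})` pointwise (`𝔤 = 𝔤₀v'^a`) fixes `E_{i+1}`,
because `[E_{i+1}:K_v] = d·p^{i+1}` divides `ord Frob_v(K(𝔤₀v'^{a+i+1}))` (sharp growth from `α`) — the step `K(𝔤v'^{i}) ↦ K(𝔤v'^{i+1})` is INERT at
`𝔓`. [cite: deShalit1987, II.1.10 (p. 39), II.4.14 (p. 71)] [cite: NeukirchANT1999, Ch. VI §7 Cor. (7.3)] -/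
theorem towerData_hinert : ∀ i : ℕ, ∀ τ : absoluteGaloisGroup (v.adicCompletion K),
    (∀ y ∈ rayClassField K (𝔤₀ * v'.asIdeal ^ a * v'.asIdeal ^ (i + 1)),
      τ • absClosureEmbedding K (v.adicCompletion K) y = absClosureEmbedding K (v.adicCompletion K) y) →
      τ ∈ (E (i + 1)).fixingSubgroup := by
  intro i τ hτ
  rw [moduli_eq₁₉] at hτ
  refine mem_fixingSubgroup_of_forall_smul_absClosureEmbedding_eq_of_finrank_dvd_orderOf (mul_ne_zero h𝔤0 (pow_ne_zero _ v'.ne_bot))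
    (not_mul_pow_le₁₉ hv hvv' _) hπ (E (i + 1)) (hE (i + 1)) ?_ hτ
  have h := mul_pow_prime_succ_dvd_orderOf_frob_idelic_of_pow_level h𝔤0 hv hv' hvv' hw𝔤 hp hpv' hpv'2 hα0 hα𝔤 hαf hℓ hαℓ ha2 hαa hd
    hdvd (n := a + (i + 1)) (by omega) hπ
  rw [show a + (i + 1) - (a + 1) + 1 = i + 1 by omega] at h
  rwa [hEdeg (i + 1)]

omit [∀ j, FiniteDimensional (v.adicCompletion K) (E j)] in
include h𝔤0 hv' hvv' hw𝔤 hp hdeg1 hpv' hpv'2 hEdeg in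
/-- ★ **`hcount`**: `[K(𝔤v'^{i+2}v^{k+1}) : K(𝔤v'^{i+1}v^{k+1})]·[E_{i+1}:K_v] ≤ [E_{i+2}:K_v]` — the layer degree is `p`
(`relfinrank_rayClassField_mul_pow_succ_succ` for `𝔣 = 𝔤₀v^{k+1}`, `𝔭 = v'` of degree one, `w_{𝔣𝔭} = 1`) and `[E_{i+2}] = p·[E_{i+1}]`.
[cite: deShalit1987, II.1.9 (p. 43), II.4.14 (p. 71)] -/
theorem towerData_hcount : ∀ i k : ℕ,
    IntermediateField.relfinrank (rayClassField K (𝔤₀ * v'.asIdeal ^ a * v'.asIdeal ^ (i + 1) * v.asIdeal ^ (k + 1)))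
        (rayClassField K (𝔤₀ * v'.asIdeal ^ a * v'.asIdeal ^ (i + 1 + 1) * v.asIdeal ^ (k + 1))) *
      Module.finrank (v.adicCompletion K) (E (i + 1)) ≤ Module.finrank (v.adicCompletion K) (E (i + 1 + 1)) := by
  intro i k
  haveI := Fact.mk hp
  have h𝔣 : 𝔤₀ * v.asIdeal ^ (k + 1) ≠ ⊥ := mul_ne_zero h𝔤0 (pow_ne_zero _ v.ne_bot)
  have hcop : IsCoprime (𝔤₀ * v.asIdeal ^ (k + 1)) v'.asIdeal :=
    (isCoprime_of_not_le₁₉ hv').mul_left (isCoprime_of_not_le₁₉ (fun h ↦ hvv' (HeightOneSpectrum.ext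
      ((v.isMaximal.eq_of_le v'.isPrime.ne_top ((Ideal.IsPrime.pow_le_iff (hP := v'.isPrime) (Nat.succ_ne_zero k)).mp h)).symm))))
  have hw' : ∀ u : (𝓞 K)ˣ, (u : 𝓞 K) - 1 ∈ 𝔤₀ * v.asIdeal ^ (k + 1) * v'.asIdeal → u = 1 :=
    fun u hu ↦ hw𝔤 u (Ideal.mul_le_right (Ideal.mul_le_right hu))
  have hrel := relfinrank_rayClassField_mul_pow_succ_succ v' hdeg1 (intValuation_natCast_eq_of_mem_of_not_mem_sq v' hpv' hpv'2) h𝔣 hcop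
    hw' (a + i)
  rw [moduli₂_eq₁₉, moduli₂_eq₁₉, show a + (i + 1) + 1 = a + i + 2 by ring, hrel, hEdeg, hEdeg, pow_succ]
  exact le_of_eq (by ring)

end Literature.NumberTheory.NumberFields

end
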